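import Summits.CriticalPhenomena.PercolationContinuityZ3.Theorems.PercNearOneGluingNoHeavyPcintChordRandForcing
import Summits.CriticalPhenomena.PercolationContinuityZ3.Theorems.PercNearOneGluingNoHeavyPcintNawRandCounting
import HarnessLib

/-!
# PCINT lane, reduction B3r: incidence times of a site and the selected forced edge pairs

Cell `prim-pcint`, seat `prim-pcint-2`; memo `run/shared/lean/prim/pcint/REDUCTIONS.md` §B3r.2 (α'), §B3r.6 (3).
Does NOT build on p205010.

For a word `γ` and a site `w` off the path, the incidence times `incTimes γ w` (times `t` with `v_t ~ w`)
are pairwise at least `2` apart (`𝕃^d` has no triangles: parity of the coordinate sum), so two incidence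
times at index distance `≥ 2` in the increasing enumeration `incAt γ w` are `≥ 4` apart and form a GAP
PAIR, forced by every open geodesic (`not_pairOpen_of_gap`).  We select, per site with `r` incidences,
`⌊r/2⌋` index-disjoint such pairs (`selIdx`, `selPairs`; for `r = 2` the unique pair, which for a charged
site is its charged gap/corner pair), prove that they are forced for the code-least open geodesic word
(`not_pairOpen_of_mem_selPairs`), that distinct selected pairs use distinct times
(`selPairs_disjoint_coords`), and that twice their number bounds the number of charged events at the
site (`card_fiber_chargedPairs_le_two_mul_card_selPairs`).
-/

noncomputable section

namespace Summit.CriticalPhenomena.PercolationContinuityZ3.Theorems.Pcint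

open Finset Literature.Probability.Percolation Literature.Probability.LatticeModels

variable {d n : ℕ}

/-! ### `𝕃^d` has no triangles -/

/-- The coordinate sum of a site. [folklore] -/
def coordSum (x : Site d) : ℤ := ∑ i, x i

/-- A lattice step changes the coordinate sum by `±1`. [folklore] -/
theorem coordSum_of_adj {x y : Site d} (h : (zdGraph d).Adj x y) :
    coordSum y = coordSum x + 1 ∨ coordSum y = coordSum x - 1 := by
  obtain ⟨⟨j, b⟩, rfl⟩ := (zdGraph_adj_iff_stepVec x y).1 h
  unfold coordSum
  simp only [Pi.add_apply, sum_add_distrib]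
  cases b
  · right
    simp [stepVec, sum_neg_distrib, Finset.sum_pi_single', sub_eq_add_neg]
  · left
    simp [stepVec, Finset.sum_pi_single']

/-- `𝕃^d` is triangle-free. [folklore] -/
theorem zdGraph_no_triangle {x y z : Site d} (h1 : (zdGraph d).Adj x y) (h2 : (zdGraph d).Adj y z)
    (h3 : (zdGraph d).Adj x z) : False := by
  rcases coordSum_of_adj h1 with a | a <;> rcases coordSum_of_adj h2 with b | b <;>
    rcases coordSum_of_adj h3 with c | c <;> omega

/-! ### Incidence times -/

/-- Membership in `incTimes`. [folklore] -/
theorem mem_incTimes {γ : Fin n → Fin d × Bool} {w : Site d} {t : ℕ} :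
    t ∈ incTimes γ w ↔ t ≤ n ∧ (zdGraph d).Adj (wordPos γ t) w := by
  rw [incTimes, mem_filter, mem_range, Nat.lt_succ_iff]

/-- Distinct incidence times are at least `2` apart. [folklore] -/
theorem incTimes_gap {γ : Fin n → Fin d × Bool} {w : Site d} {i j : ℕ} (hi : i ∈ incTimes γ w)
    (hj : j ∈ incTimes γ w) (hij : i < j) : i + 2 ≤ j := by
  by_contra h
  have hj1 : j = i + 1 := by omega
  subst hj1
  obtain ⟨-, hai⟩ := mem_incTimes.1 hi
  obtain ⟨hjn, haj⟩ := mem_incTimes.1 hj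
  exact zdGraph_no_triangle hai haj.symm (zdGraph_adj_wordPos_succ γ (by omega))

/-- The `k`-th incidence time in increasing order (junk `0` for `k ≥ #incTimes`). [folklore] -/
def incAt (γ : Fin n → Fin d × Bool) (w : Site d) (k : ℕ) : ℕ :=
  if h : k < (incTimes γ w).card then (incTimes γ w).orderEmbOfFin rfl ⟨k, h⟩ else 0

/-- `incAt` enumerates incidence times. [folklore] -/
theorem incAt_mem {γ : Fin n → Fin d × Bool} {w : Site d} {k : ℕ} (hk : k < (incTimes γ w).card) :
    incAt γ w k ∈ incTimes γ w := by
  rw [incAt, dif_pos hk]; exact orderEmbOfFin_mem _ _ _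

/-- `incAt` is strictly increasing below `#incTimes`. [folklore] -/
theorem incAt_strictMono {γ : Fin n → Fin d × Bool} {w : Site d} {k l : ℕ} (hkl : k < l)
    (hl : l < (incTimes γ w).card) : incAt γ w k < incAt γ w l := by
  rw [incAt, dif_pos (hkl.trans hl), incAt, dif_pos hl]
  exact (OrderEmbedding.strictMono _) (Fin.mk_lt_mk.2 hkl)

/-- `incAt` is injective below `#incTimes`. [folklore] -/
theorem incAt_inj {γ : Fin n → Fin d × Bool} {w : Site d} {k l : ℕ} (hk : k < (incTimes γ w).card)
    (hl : l < (incTimes γ w).card) (h : incAt γ w k = incAt γ w l) : k = l := by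
  by_contra hne
  rcases Nat.lt_or_gt_of_ne hne with hlt | hlt
  · exact (incAt_strictMono hlt hl).ne h
  · exact (incAt_strictMono hlt hk).ne h.symm

/-- Every incidence time is enumerated. [folklore] -/
theorem exists_incAt_eq {γ : Fin n → Fin d × Bool} {w : Site d} {t : ℕ} (ht : t ∈ incTimes γ w) :
    ∃ k < (incTimes γ w).card, incAt γ w k = t := by
  have : t ∈ Set.range ((incTimes γ w).orderEmbOfFin rfl) := by rw [range_orderEmbOfFin]; exact mem_coe.2 ht
  obtain ⟨⟨k, hk⟩, hkt⟩ := this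
  exact ⟨k, hk, by rw [incAt, dif_pos hk]; exact hkt⟩

/-- Incidence times at index distance `l - k` are at least `2 (l - k)` apart. [folklore] -/
theorem incAt_gap {γ : Fin n → Fin d × Bool} {w : Site d} {k l : ℕ} (hkl : k ≤ l)
    (hl : l < (incTimes γ w).card) : incAt γ w k + 2 * (l - k) ≤ incAt γ w l := by
  induction l, hkl using Nat.le_induction with
  | base => simp
  | succ l hkl ih =>
    have h1 := ih (by omega)
    have h2 := incTimes_gap (incAt_mem (by omega : l < _)) (incAt_mem hl) (incAt_strictMono (by omega) hl)
    omega

/-- With exactly two incidences, any two incidence times `i < j` are the two enumerated ones. [folklore] -/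
theorem eq_incAt_of_card_two {γ : Fin n → Fin d × Bool} {w : Site d} (h2 : (incTimes γ w).card = 2) {i j : ℕ}
    (hi : i ∈ incTimes γ w) (hj : j ∈ incTimes γ w) (hij : i < j) : i = incAt γ w 0 ∧ j = incAt γ w 1 := by
  obtain ⟨k, hk, rfl⟩ := exists_incAt_eq hi
  obtain ⟨l, hl, rfl⟩ := exists_incAt_eq hj
  rw [h2] at hk hl
  have hkl : k < l := by
    by_contra hle
    rcases Nat.lt_or_ge l k with h | h
    · exact (lt_asymm hij) (incAt_strictMono h (by omega))
    · have : k = l := by omega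
      subst this; exact lt_irrefl _ hij
  obtain ⟨rfl, rfl⟩ : k = 0 ∧ l = 1 := ⟨by omega, by omega⟩
  exact ⟨rfl, rfl⟩

/-! ### Selected index pairs -/

/-- The selected index pairs for `r` incidences: `(a, a + ⌊r/2⌋)` for `a < ⌊r/2⌋` when `r ≥ 4`; `(0,2)` for
`r = 3`; `(0,1)` for `r = 2`; none otherwise. [folklore] -/
def selIdx (r : ℕ) : Finset (ℕ × ℕ) :=
  if 4 ≤ r then (range (r / 2)).image fun a => (a, a + r / 2)
  else if r = 3 then {(0, 2)} else if r = 2 then {(0, 1)} else ∅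

/-- Shape of a selected index pair. [folklore] -/
theorem mem_selIdx {r : ℕ} {ab : ℕ × ℕ} (h : ab ∈ selIdx r) :
    ab.1 < ab.2 ∧ ab.2 < r ∧ (3 ≤ r → ab.1 + 2 ≤ ab.2) := by
  unfold selIdx at h
  split_ifs at h with h4 h3 h2
  · rw [mem_image] at h
    obtain ⟨a, ha, rfl⟩ := h
    rw [mem_range] at ha
    refine ⟨by simp only; omega, by simp only; omega, fun _ => by simp only; omega⟩
  · rw [mem_singleton] at h; subst h; refine ⟨by norm_num, by omega, fun _ => by norm_num⟩
  · rw [mem_singleton] at h; subst h; refine ⟨by norm_num, by omega, fun h => by omega⟩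
  · simp at h

/-- Distinct selected index pairs use disjoint indices. [folklore] -/
theorem selIdx_disjoint {r : ℕ} {ab ab' : ℕ × ℕ} (h : ab ∈ selIdx r) (h' : ab' ∈ selIdx r) (hne : ab ≠ ab') :
    ab.1 ≠ ab'.1 ∧ ab.1 ≠ ab'.2 ∧ ab.2 ≠ ab'.1 ∧ ab.2 ≠ ab'.2 := by
  unfold selIdx at h h'
  split_ifs at h h' with h4 h3 h2
  · rw [mem_image] at h h'
    obtain ⟨a, ha, rfl⟩ := h
    obtain ⟨a', ha', rfl⟩ := h'
    rw [mem_range] at ha ha'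
    have haa : a ≠ a' := fun he => hne (by rw [he])
    simp only [ne_eq]
    omega
  · rw [mem_singleton] at h h'; exact (hne (h.trans h'.symm)).elim
  · rw [mem_singleton] at h h'; exact (hne (h.trans h'.symm)).elim
  · simp at h

/-- Twice the number of selected pairs is at least `r - 1`. [folklore] -/
theorem pred_le_two_mul_card_selIdx (r : ℕ) : r - 1 ≤ 2 * (selIdx r).card := by
  unfold selIdx
  split_ifs with h4 h3 h2
  · rw [card_image_of_injective _ (fun a a' h => (Prod.mk.inj h).1), card_range]; omega
  · simp [h3]
  · simp [h2]
  · simp; omega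

/-- The selected pairs of incidence TIMES of the site `w` along `γ`. [folklore] -/
def selPairs (γ : Fin n → Fin d × Bool) (w : Site d) : Finset (ℕ × ℕ) :=
  (selIdx (incTimes γ w).card).image fun ab => (incAt γ w ab.1, incAt γ w ab.2)

/-- The enumeration map is injective on selected index pairs. [folklore] -/
theorem selPairs_map_injOn (γ : Fin n → Fin d × Bool) (w : Site d) :
    Set.InjOn (fun ab : ℕ × ℕ => (incAt γ w ab.1, incAt γ w ab.2)) ↑(selIdx (incTimes γ w).card) := by
  intro ab hab ab' hab' h
  obtain ⟨h1, h2, -⟩ := mem_selIdx (mem_coe.1 hab)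
  obtain ⟨h1', h2', -⟩ := mem_selIdx (mem_coe.1 hab')
  obtain ⟨ha, hb⟩ := Prod.mk.inj h
  exact Prod.ext (incAt_inj (by omega) (by omega) ha) (incAt_inj h2 h2' hb)

/-- The number of selected pairs. [folklore] -/
theorem card_selPairs (γ : Fin n → Fin d × Bool) (w : Site d) :
    (selPairs γ w).card = (selIdx (incTimes γ w).card).card :=
  card_image_of_injOn (selPairs_map_injOn γ w)

/-- Shape of a selected time pair: two incidence times `i < j ≤ n` of `w`, at least `4` apart unless `w`
has exactly two incidences. [folklore] -/
theorem mem_selPairs {γ : Fin n → Fin d × Bool} {w : Site d} {ij : ℕ × ℕ} (h : ij ∈ selPairs γ w) :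
    ij.1 ∈ incTimes γ w ∧ ij.2 ∈ incTimes γ w ∧ ij.1 < ij.2 ∧
      (3 ≤ (incTimes γ w).card → ij.1 + 4 ≤ ij.2) ∧ 2 ≤ (incTimes γ w).card := by
  rw [selPairs, mem_image] at h
  obtain ⟨ab, hab, rfl⟩ := h
  obtain ⟨h1, h2, h3⟩ := mem_selIdx hab
  refine ⟨incAt_mem (by omega), incAt_mem h2, incAt_strictMono h1 h2, fun hr => ?_, by omega⟩
  have := incAt_gap (w := w) (γ := γ) h1.le h2
  have := h3 hr
  simp only
  omega

/-- Distinct selected time pairs of one site involve four distinct times. [folklore] -/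
theorem selPairs_disjoint_coords {γ : Fin n → Fin d × Bool} {w : Site d} {ij ij' : ℕ × ℕ}
    (h : ij ∈ selPairs γ w) (h' : ij' ∈ selPairs γ w) (hne : ij ≠ ij') :
    ij.1 ≠ ij'.1 ∧ ij.1 ≠ ij'.2 ∧ ij.2 ≠ ij'.1 ∧ ij.2 ≠ ij'.2 := by
  rw [selPairs, mem_image] at h h'
  obtain ⟨ab, hab, rfl⟩ := h
  obtain ⟨ab', hab', rfl⟩ := h'
  have hne' : ab ≠ ab' := fun he => hne (by rw [he])
  obtain ⟨a1, a2, -⟩ := mem_selIdx hab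
  obtain ⟨b1, b2, -⟩ := mem_selIdx hab'
  obtain ⟨c1, c2, c3, c4⟩ := selIdx_disjoint hab hab' hne'
  simp only [ne_eq]
  exact ⟨fun he => c1 (incAt_inj (by omega) (by omega) he), fun he => c2 (incAt_inj (by omega) b2 he),
    fun he => c3 (incAt_inj a2 (by omega) he), fun he => c4 (incAt_inj a2 b2 he)⟩

/-! ### The selected pairs of a charged site are forced -/

/-- The corner site is adjacent to `v_s`. [folklore] -/
theorem adj_cornerSite (γ : Fin n → Fin d × Bool) {s : ℕ} (h : s + 1 < n) :
    (zdGraph d).Adj (wordPos γ s) (cornerSite γ s) := by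
  rw [zdGraph_adj_iff_stepVec]
  exact ⟨γ ⟨s + 1, h⟩, by rw [cornerSite, dif_pos h]⟩

/-- The charged events at a site are at most `#incTimes - 1` (charged times are incidence times other than
the first). [folklore] -/
theorem card_fiber_chargedPairs_le_pred {o : Orders d n} {γ : Fin n → Fin d × Bool} (hγ : IsSAW γ)
    (w : Site d) : ((chargedPairs o γ).filter fun x => x.2 = w).card ≤ (incTimes γ w).card - 1 := by
  set Fw := (chargedPairs o γ).filter fun x => x.2 = w with hFw
  rcases Fw.eq_empty_or_nonempty with h0 | hne
  · rw [h0, card_empty]; exact Nat.zero_le _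
  obtain ⟨x₀, hx₀⟩ := hne
  obtain ⟨hx₀1, hx₀2⟩ := mem_filter.1 hx₀
  obtain ⟨-, -, i₀, hi₀, hi₀w⟩ := chargedPairs_spec hx₀1
  have hle₀ := (chargedPairs_spec hx₀1).1
  rw [hx₀2] at hi₀w
  have hI : (incTimes γ w).Nonempty := ⟨i₀, mem_incTimes.2 ⟨by omega, hi₀w⟩⟩
  have hT : Fw.image Prod.fst ⊆ (incTimes γ w).erase ((incTimes γ w).min' hI) := by
    intro t ht
    rw [mem_image] at ht
    obtain ⟨x, hx, rfl⟩ := ht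
    obtain ⟨hx1, hx2⟩ := mem_filter.1 hx
    obtain ⟨hle, hadj, i, hi, hiw⟩ := chargedPairs_spec hx1
    rw [hx2] at hadj hiw
    have hiI : i ∈ incTimes γ w := mem_incTimes.2 ⟨by omega, hiw⟩
    refine mem_erase.2 ⟨fun htm => ?_, mem_incTimes.2 ⟨hle, hadj⟩⟩
    have := (incTimes γ w).min'_le i hiI
    rw [← htm] at this
    omega
  have hinj : Set.InjOn Prod.fst (Fw : Set (ℕ × Site d)) := by
    intro x hx y hy hxy
    have hx2 := (mem_filter.1 (mem_coe.1 hx)).2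
    have hy2 := (mem_filter.1 (mem_coe.1 hy)).2
    exact Prod.ext hxy (hx2.trans hy2.symm)
  have _ := hγ
  calc Fw.card = (Fw.image Prod.fst).card := (card_image_of_injOn hinj).symm
    _ ≤ ((incTimes γ w).erase ((incTimes γ w).min' hI)).card := card_le_card hT
    _ = (incTimes γ w).card - 1 := card_erase_of_mem (min'_mem _ _)

/-- **Cap**: the charged events at a site are at most twice the number of selected pairs. [folklore] -/
theorem card_fiber_chargedPairs_le_two_mul_card_selPairs {o : Orders d n} {γ : Fin n → Fin d × Bool}
    (hγ : IsSAW γ) (w : Site d) :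
    ((chargedPairs o γ).filter fun x => x.2 = w).card ≤ 2 * (selPairs γ w).card := by
  rw [card_selPairs]
  exact (card_fiber_chargedPairs_le_pred hγ w).trans (pred_le_two_mul_card_selIdx _)

/-- **The selected pairs of a charged site are forced**: for the code-least open geodesic word `γ` of
`ω ⊆ E(𝕃^d)`, a site `w ∈ forcedSites o γ` and `(i, j) ∈ selPairs γ w`, the edges `{v_i, w}`, `{w, v_j}`
are not both open. [folklore] -/
theorem not_pairOpen_of_mem_selPairs {ω : BondConfig (Site d)} (hω : ω ⊆ (zdGraph d).edgeSet)
    {o : Orders d n} {γ : Fin n → Fin d × Bool} (hγ : γ ∈ bgeoWords ω n)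
    (hmin : ∀ γ' ∈ bgeoWords ω n, code o γ ≤ code o γ') {w : Site d} (hw : w ∈ forcedSites o γ)
    {ij : ℕ × ℕ} (hij : ij ∈ selPairs γ w) :
    ¬ (s(wordPos γ ij.1, w) ∈ ω ∧ s(w, wordPos γ ij.2) ∈ ω) := by
  obtain ⟨hi, hj, hlt, hgap, h2⟩ := mem_selPairs hij
  obtain ⟨hjn, -⟩ := mem_incTimes.1 hj
  by_cases hr : 3 ≤ (incTimes γ w).card
  · exact not_pairOpen_of_gap hω hγ (by have := hgap hr; omega) hjn
  · -- exactly two incidences: the pair is the charged pair of `w`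
    have hr2 : (incTimes γ w).card = 2 := by omega
    obtain ⟨hi0, hj1⟩ := eq_incAt_of_card_two hr2 hi hj hlt
    rw [forcedSites, mem_image] at hw
    obtain ⟨x, hx, hxw⟩ := hw
    have hspec := chargedPairs_spec hx
    rw [hxw] at hspec
    obtain ⟨hxn, hxadj, i', hi', hi'w⟩ := hspec
    have hxI : x.1 ∈ incTimes γ w := mem_incTimes.2 ⟨hxn, hxadj⟩
    have hi'I : i' ∈ incTimes γ w := mem_incTimes.2 ⟨by omega, hi'w⟩
    obtain ⟨-, hx1⟩ := eq_incAt_of_card_two hr2 hi'I hxI hi'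
    rw [chargedPairs, mem_union] at hx
    rcases hx with hx | hx
    · -- a gap event: an incidence `i'' + 3 ≤ x.1`, necessarily `i'' = ij.1`
      rw [gapPairs, mem_biUnion] at hx
      obtain ⟨t, -, hx⟩ := hx
      rw [mem_image] at hx
      obtain ⟨w', hw', hxe⟩ := hx
      have ht : t = x.1 := by rw [← hxe]
      have hww : w' = w := by rw [← hxw, ← hxe]
      subst hww
      obtain ⟨-, -, i'', hi''3, hi''w⟩ := mem_gapSet.1 hw'
      have hi''I : i'' ∈ incTimes γ w' := mem_incTimes.2 ⟨by omega, hi''w⟩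
      obtain ⟨hi''0, -⟩ := eq_incAt_of_card_two hr2 hi''I hxI (by omega)
      exact not_pairOpen_of_gap hω hγ (by rw [hi0, hj1, ← hi''0, ← hx1]; omega) hjn
    · -- a bad corner event at `s` with `w = cornerSite γ s`, pair `(s, s + 2)`
      rw [badPairs, mem_image] at hx
      obtain ⟨s, hs, hxe⟩ := hx
      obtain ⟨hcor, hbad⟩ := mem_badTimes.1 hs
      have hsn : (s : ℕ) + 2 ≤ n := hcor.fst
      have hws : w = cornerSite γ s := by rw [← hxw, ← hxe]
      have hx1' : x.1 = (s : ℕ) + 2 := by rw [← hxe]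
      have hsI : (s : ℕ) ∈ incTimes γ w := mem_incTimes.2 ⟨by omega, by rw [hws]; exact adj_cornerSite γ (by omega)⟩
      obtain ⟨hs0, -⟩ := eq_incAt_of_card_two hr2 hsI hxI (by omega)
      have hi_eq : ij.1 = s := by rw [hi0, ← hs0]
      have hj_eq : ij.2 = (s : ℕ) + 2 := by rw [hj1, ← hx1, hx1']
      rw [hi_eq, hj_eq, hws]
      exact not_cornerPairOpen_of_minimal hγ hmin hbad

end Summit.CriticalPhenomena.PercolationContinuityZ3.Theorems.Pcint
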